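import Literature.MathematicalPhysics.QuantumFieldTheory.ConformalBootstrap3D.PointKernelK34L505Data
import Literature.MathematicalPhysics.QuantumFieldTheory.ConformalBootstrap3D.PointKernelK34L505Segs
import Literature.MathematicalPhysics.QuantumFieldTheory.ConformalBootstrap3D.PointKernelParts

/-!
# K34L505 certificate, kernel part file P21: one-cell head segments 94, 95 in level ranges

The head cells whose kernel evaluation exceeds one `decide` are one-cell segments of `hsegsK34L505`; each is
checked by `PCert.hPartSideOK` (side conditions) and `PCert.hPartOK` per level range `[n_lo, n_lo + count)`
against an integer claim, the claims summing to `≥ 0` (`PointKernel.partsOK`); soundness is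
`PCert.hParts_sound` (`PointKernelParts`).  The part files are mutually independent (each imports only
the data file); the ranges of one cell may span several of them, and the per-cell conclusions
`hparts_i` / `hcell_i` of those cells are assembled in `PointKernelK34L505.lean`.
Estimated kernel time 244 s.
-/

set_option maxRecDepth 100000
set_option maxHeartbeats 0

namespace Literature.MathematicalPhysics.QuantumFieldTheory.ConformalBootstrap3D.PointKernelK34L505

open Literature.MathematicalPhysics.QuantumFieldTheory.ConformalBootstrap3D.PointKernel

/-- levels `[64, 68)` of segment 94: partial lower sum `≥` claim. [folklore] -/
theorem part_94_7 : certK34L505.hPartOK (PCert.segAt hsegsK34L505 94) JHK34L505 64 4 (158501656830264993353882899960640286) = true := by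
  decide +kernel

/-- levels `[68, 71)` of segment 94: partial lower sum `≥` claim. [folklore] -/
theorem part_94_8 : certK34L505.hPartOK (PCert.segAt hsegsK34L505 94) JHK34L505 68 3 (71730894529507305423175606550073699) = true := by
  decide +kernel

/-- levels `[71, 73)` of segment 94: partial lower sum `≥` claim. [folklore] -/
theorem part_94_9 : certK34L505.hPartOK (PCert.segAt hsegsK34L505 94) JHK34L505 71 2 (27726251095611202656959261002416260) = true := by
  decide +kernel

/-- one-cell segment 95 (row 6, cell `[28673/4096, 14337/2048]`, chord, `n_F = 72`,
10 level ranges): side conditions. [folklore] -/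
theorem pside_95 : certK34L505.hPartSideOK (PCert.segAt hsegsK34L505 95) JHK34L505 = true := by
  decide +kernel

/-- its level ranges `(n_lo, count, claim)`. [folklore] -/
def partsK34L505_95 : List (ℕ × ℕ × ℤ) := [(0, 25, -28636930149030249463693716713920855188), (25, 11, 18389833777167428573685066125951321475), (36, 8, 5997792376057866043578219258977880825), (44, 6, 2151944397306605040509672894110000172), (50, 5, 978530397656405839549393713470419819), (55, 5, 560544387651575775309960979869081291), (60, 4, 267509811026338807918856815584918632), (64, 4, 169039251015207744214379368368777603), (68, 3, 82741133228087758873288552350426541), (71, 2, 38994617920733880054879005238028836)]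

/-- the ranges tile `[0, n_F]` and the claims sum to `≥ 0`. [folklore] -/
theorem pcov_95 : PointKernel.partsOK 72 partsK34L505_95 = true := by
  decide +kernel

/-- levels `[0, 25)` of segment 95: partial lower sum `≥` claim. [folklore] -/
theorem part_95_0 : certK34L505.hPartOK (PCert.segAt hsegsK34L505 95) JHK34L505 0 25 (-28636930149030249463693716713920855188) = true := by
  decide +kernel

end Literature.MathematicalPhysics.QuantumFieldTheory.ConformalBootstrap3D.PointKernelK34L505
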